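import Literature.NumberTheory.Automorphic.ParabolicGL
import HarnessLib

/-!
# Zelevinsky 1980, Thm. 4.2 — the case of the maximal parabolic `Q_{N-1,1}` and UNITARY characters:
# `(ν ∘ det_{GL_{N-1}}) × χ′` is irreducible (named fact, stated over the tree's `Representation.parabolicIndGL`)

A. V. Zelevinsky, *Induced representations of reductive p-adic groups II. On irreducible representations of GL(n)*,
Ann. Sci. ÉNS (4) 13 (1980) 165–210 [Zelevinsky1980] (held: `paper:doi-10-24033-asens-1379`, PDF page = journal page
− 163).  Setting §1.1 (p. 170): `F` a local non-archimedean field, `G_n = GL(n, F)`, `ρ₁ × ρ₂ = i_{G_n, G_{(n₁,n₂)}}(ρ₁ ⊗ ρ₂)`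
the NORMALISED induction of [BernsteinZelevinsky1977, §2.3] from the standard (block upper triangular) parabolic with
Levi `G_{n₁} × G_{n₂}`; `ν(g) = |det g|` (§3.1).  A SEGMENT is `Δ = [ρ, ν^k ρ] = {ρ, νρ, …, ν^k ρ}` for a cuspidal `ρ`,
and `⟨Δ⟩` the unique irreducible submodule of `ρ × νρ × ⋯ × ν^k ρ` (§3.1 p. 180–181).

THE PRINTED STATEMENTS (verbatim from the held text):
* §3.2 Example (p. 181, p0018 L10–L12): «Let `ρ ∈ Irr G₁`. Since `G₁ = F*` is abelian `ρ` is one-dimensional, i.e. it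
  is a multiplicative character of `F`. If … `Δ = [ρ, ρ′]` then `ω = ⟨Δ⟩ ∈ Irr G_{k+1}` is onedimensional:
  `ω(g) = ν^{k/2}(g)·ρ(det g)`, `g ∈ G_{k+1}`.»  (So for a character `ν₀` of `Fˣ`, `ν₀ ∘ det` on `G_m` is `⟨Δ⟩` for
  `Δ = [ν₀ ν^{(1-m)/2}, ν₀ ν^{(m-1)/2}]`, and «it is convenient to denote by `⟨∅⟩` the identity representation of the group
  `G₀ = {e}`» (p. 181 L5–L6).)
* §4.1 (p. 184, p0021 L11–L12): «We say that `Δ₁` and `Δ₂` are linked if `Δ₁ ⊄ Δ₂`, `Δ₂ ⊄ Δ₁` and `Δ₁ ∪ Δ₂` is also a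
  segment.»
* §4.2 THEOREM (p. 184, p0021 L44–L48): «Let `Δ₁, …, Δ_r` be segments in `𝒞`. The following conditions are
  equivalent: (1) The representation `⟨Δ₁⟩ × ⋯ × ⟨Δ_r⟩` is irreducible. (2) For each `i, j = 1, …, r` the segments `Δ_i`
  and `Δ_j` are not linked.»

THE CASE RECORDED HERE ((2) ⇒ (1) with `r = 2`): for UNITARY characters `ν₀`, `χ′` of `Fˣ` the segments
`Δ₁ = [ν₀ ν^{(2-N)/2}, ν₀ ν^{(N-2)/2}]` (so `⟨Δ₁⟩ = ν₀ ∘ det` on `G_{N-1}`) and `Δ₂ = [χ′]` (on `G₁`) are NEVER linked: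
`Δ₁ ∪ Δ₂` is a segment not containing either only if `χ′ = ν₀ ν^{±N/2}`, impossible for `|ν₀| = |χ′| = 1` and `N ≥ 1`
(compare central characters, as in [BernsteinZelevinsky1977, 4.2 Remark (1)], p. 455: «`ρ ≄ νρ` since `ρ` and `νρ` differ,
when restricted to the center»).  Hence `(ν₀ ∘ det_{G_{N-1}}) × χ′` is IRREDUCIBLE.  This is the irreducibility input of
[Liu2021, App. D, proof of Lemma D.1, first paragraph, p. 126]: at a split place «`ω(μ, ε, χ)` is isomorphic to the unitary
induction from `Q_{n-1,1}(F)` to `GL_n(F)` of the (unitary) character `(ν∘det) ⊠ χν^{1-n}` … See for example [GR90] 2.6.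
The lemma follows from such description.» (there `ν` is unitary, `μ = ν ⊠ ν⁻¹`, and `χν^{1-n}` is unitary).

LEAN OBJECTS (all the tree's, nothing redefined): `Representation.parabolicIndGL F c σ` (`Automorphic/ParabolicGL.lean`:
normalised smooth induction `Ind_{P_c}^{GL_n}(σ ∘ leviProjection ⊗ δ_{P_c}^{1/2})`, right-translation model `f(pg) =
σ(p)δ^{1/2}(p)f(g)` of `Automorphic/SmoothInduction.lean`, `δ_B(diag(a,d)) = |a/d|` — exactly the `×` of print), with the
block labelling `lastBlockLabel N : Fin N → Bool` (`i ↦ (N ≤ i+1)`: the LAST index is the block `true`, `false < true`, so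
`P_c = Q_{N-1,1}` is block UPPER triangular with the `GL_{N-1}` block FIRST, as in print's `ρ₁ × ρ₂`), and the Levi character
`maxParabolicLeviChar F N ν₀ χ′ : (Π a, GL {i // lastBlockLabel N i = a} F) →* ℂˣ`, `(m_false, m_true) ↦ ν₀(det m_false)
χ′(det m_true)`, turned into the one-dimensional representation `(Representation.trivial ℂ _ ℂ).twist (…)` (tree `twist`).
«irreducible» = Mathlib's `Representation.IsIrreducible` (the induced space is non-zero).  Characters are `Fˣ →* ℂˣ`,
UNITARY (`‖·‖ = 1`) and CONTINUOUS (print's characters are smooth; both hypotheses are needed for truth: a discontinuous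
`ν₀` makes the smooth induction degenerate, a non-unitary one meets the linked case `χ′ = ν₀|·|^{±N/2}`).
DEGENERATE `N` (ref2 V4): `N = 0, 1` give one-dimensional induced representations (empty `GL_{N-1}` block resp. trivial
group), irreducible — true, and print's `⟨∅⟩` convention covers them.  `[LocallyCompactSpace ↥P_c]` is the standing
instance hypothesis of `parabolicIndGL` (true: `P_c` is closed in `GL_N(F)`), kept as a binder exactly as in the tree's
`Representation.isAdmissible_parabolicIndGL`.

CONSUMER (cell hodgecm-mathlib, fan A rung A-IV): `hD1''` / `hD3` at a SPLIT place `v` of `F⁺` (interface list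
INTERFACE-BIV row IV-3 (b)), through the split-place model of the `χ_v`-coinvariants of the local Weil representation
(row IV-3 (a)) and `UnitaryGroup.localPiSplitEquiv : U(J)(F_v) ≃ₜ* GL_N(E_w)`; companions: admissibility
`Representation.isAdmissible_parabolicIndGL` (named fact, [BernsteinZelevinsky1977, Prop. 2.3]) and finite length
`Representation.isFiniteLength_parabolicIndGL`.

This file: two definitions with bodies (the labelling and the Levi character) + their unfolding lemmas, and ONE NAMED FACT
(D-0014; not proved here — the proof in print is Zelevinsky's derivative calculus §4.3–4.7).  No `sorry`, no axiom, no
instance, no notation.  HC_CM is not mentioned further and is NOT proved by anything here.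

## References
* [Zelevinsky1980] A. V. Zelevinsky, Ann. Sci. ÉNS 13 (1980) 165–210: §1.1 p. 170, §3.1–3.2 p. 180–181, §4.1–4.2 p. 184.
* [BernsteinZelevinsky1977] I. N. Bernstein, A. V. Zelevinsky, Ann. Sci. ÉNS 10 (1977) 441–472: §2.3 (the functors
  `i_{G,M}`), 4.2 Thm. + Remarks p. 455 (cuspidal case; held `paper:doi-10-24033-asens-1333`).
* [Liu2021] Y. Liu, Camb. J. Math. 9 (2021), App. D, proof of Lemma D.1, p. 126.
-/

noncomputable section

namespace Literature.NumberTheory.Automorphic.Zelevinsky1980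

universe u

/-! ## §1 The maximal standard parabolic `Q_{N-1,1}` of `GL_N` and its one-dimensional inducing data -/

/-- The block labelling of the maximal standard parabolic `Q_{N-1,1} ≤ GL_N`: index `i` is labelled `true` iff it is
the LAST one (`N ≤ i + 1`), so the blocks are `{0, …, N-2}` (`false`, a `GL_{N-1}`) and `{N-1}` (`true`, a `GL₁`), and
`standardParabolicGL R (lastBlockLabel N)` is block UPPER triangular with the `GL_{N-1}` block first (print's
`G_{(N-1,1)} ≤ P`, [Zelevinsky1980, §1.1 p. 170]). [cite: Zelevinsky1980, §1.1, p. 170] -/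
def lastBlockLabel (N : ℕ) : Fin N → Bool := fun i => decide (N ≤ (i : ℕ) + 1)

/-- unfolding: `lastBlockLabel N i = decide (N ≤ i + 1)` (so the label is `true` iff `i = N - 1`).
[cite: Zelevinsky1980, §1.1, p. 170] -/
theorem lastBlockLabel_apply (N : ℕ) (i : Fin N) : lastBlockLabel N i = decide (N ≤ (i : ℕ) + 1) := rfl

/-- **The Levi character `(ν₀ ∘ det) ⊠ χ′`** of `G_{(N-1,1)} = GL_{N-1}(F) × GL₁(F)` (as the tree presents the standard
Levi: `Π a : Bool, GL {i // lastBlockLabel N i = a} F`): `(m_a)_a ↦ ν₀(det m_false) · χ′(det m_true)` — print's inducing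
datum `⟨Δ₁⟩ ⊗ ⟨Δ₂⟩` with `⟨Δ₁⟩ = ν₀ ∘ det` ([Zelevinsky1980, §3.2 Example, p. 181]) and `⟨Δ₂⟩ = χ′`.
[cite: Zelevinsky1980, §3.2 Example, p. 181] -/
def maxParabolicLeviChar (F : Type u) [Field F] (N : ℕ) (ν₀ χ' : Fˣ →* ℂˣ) :
    (Π a : Bool, GL {i : Fin N // lastBlockLabel N i = a} F) →* ℂˣ :=
  (ν₀.comp (Matrix.GeneralLinearGroup.det.comp
      (Pi.evalMonoidHom (fun a : Bool => GL {i : Fin N // lastBlockLabel N i = a} F) false))) *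
    (χ'.comp (Matrix.GeneralLinearGroup.det.comp
      (Pi.evalMonoidHom (fun a : Bool => GL {i : Fin N // lastBlockLabel N i = a} F) true)))

/-- unfolding: `maxParabolicLeviChar F N ν₀ χ′ m = ν₀ (det (m false)) * χ′ (det (m true))`.
[cite: Zelevinsky1980, §3.2 Example, p. 181] -/
theorem maxParabolicLeviChar_apply (F : Type u) [Field F] (N : ℕ) (ν₀ χ' : Fˣ →* ℂˣ)
    (m : Π a : Bool, GL {i : Fin N // lastBlockLabel N i = a} F) :
    maxParabolicLeviChar F N ν₀ χ' m =
      ν₀ (Matrix.GeneralLinearGroup.det (m false)) * χ' (Matrix.GeneralLinearGroup.det (m true)) :=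
  rfl

/-! ## §2 [Zelevinsky1980, Thm. 4.2 (2) ⇒ (1)] for `⟨Δ₁⟩ = ν₀ ∘ det_{GL_{N-1}}`, `⟨Δ₂⟩ = χ′`, both unitary -/

/-- **[Zelevinsky1980, Thm. 4.2 (2) ⇒ (1), p. 184, with §3.2 Example p. 181] — unitary characters on `Q_{N-1,1}`.**
Print: «Let `Δ₁, …, Δ_r` be segments in `𝒞`. The following conditions are equivalent: (1) The representation
`⟨Δ₁⟩ × ⋯ × ⟨Δ_r⟩` is irreducible. (2) For each `i, j = 1, …, r` the segments `Δ_i` and `Δ_j` are not linked.» and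
«`⟨[ρ, ρ′]⟩ … is onedimensional: `ω(g) = ν^{k/2}(g)·ρ(det g)`».  THE CASE RECORDED: for a non-archimedean local field `F`,
`N : ℕ`, and UNITARY CONTINUOUS characters `ν₀, χ′ : Fˣ → ℂˣ`, the normalised parabolic induction
`(ν₀ ∘ det_{GL_{N-1}}) × χ′ = i_{GL_N, G_{(N-1,1)}}((ν₀ ∘ det) ⊠ χ′)` — the tree's
`Representation.parabolicIndGL F (lastBlockLabel N) ((Representation.trivial ℂ _ ℂ).twist (maxParabolicLeviChar F N ν₀ χ′))`
— is IRREDUCIBLE (`Representation.IsIrreducible`), the segments `[ν₀ν^{(2-N)/2}, ν₀ν^{(N-2)/2}]` and `[χ′]` being never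
linked for unitary `ν₀, χ′` (module docstring).  A named fact (D-0014), not proved here.
[cite: Zelevinsky1980, Thm. 4.2 (2)⇒(1), p. 184 (with §3.2 Example, p. 181)] -/
def parabolicIndGL_detChar_unitary_isIrreducible : Prop :=
  ∀ (F : Type u) [Field F] [ValuativeRel F] [TopologicalSpace F] [IsNonarchimedeanLocalField F] (N : ℕ)
    [LocallyCompactSpace (standardParabolicGL F (lastBlockLabel N))]
    (ν₀ χ' : Fˣ →* ℂˣ) (hν₀u : ∀ x, ‖((ν₀ x : ℂˣ) : ℂ)‖ = 1) (hν₀c : Continuous fun x => ((ν₀ x : ℂˣ) : ℂ))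
    (hχ'u : ∀ x, ‖((χ' x : ℂˣ) : ℂ)‖ = 1) (hχ'c : Continuous fun x => ((χ' x : ℂˣ) : ℂ)),
    (Representation.parabolicIndGL F (lastBlockLabel N)
      ((Representation.trivial ℂ (Π a : Bool, GL {i : Fin N // lastBlockLabel N i = a} F) ℂ).twist
        (maxParabolicLeviChar F N ν₀ χ'))).IsIrreducible

end Literature.NumberTheory.Automorphic.Zelevinsky1980

end
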